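import Mathlib

/-!
# PP(12), order-11 cell, Case B (`NoTriangleData12`): KERNEL FUNCTIONS of the certificate (designs g23)
Framing: lottery ticket; floor = certified bounds/negative ranges.

Cell pub-namedobj (venture DiscreteObjects), target (M). `NoTriangleData12` (`OrderElevenCollineation`) says that no Case-B data
`D : TriangleData 11` (a collineation of order 11 of a projective plane of order 12 fixing exactly a triangle, FAMILY-B1P §3) are `Valid`.
This file holds ONLY the executable side of the kernel certificate, on packed naturals:

* residue sets `⊆ Z₁₁` are 11-bit masks; `rot B v` is the translate `B − v`; a map `φ : Z₁₁ → Z₁₁` is packed as `P = Σ φ(t)·16^t`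
  (`dig P t = φ t`);
* **rows.** A row of valid data (free line orbit `s`) is the family of blocks `E_{s,t} ⊆ Z₁₁ ∖ {0}` with its side positions `g₁, g₂`;
  it is packed as `r = (A <<< 8) ||| (g₁ <<< 4) ||| g₂`, `A = Σ_t mask(E_{s,t}) <<< 22t`. `partsEnum` enumerates the 545 partitions of
  `{1,…,10}` into blocks whose internal differences are pairwise distinct and exhaust `Z₁₁ ∖ {0}` (conditions (K0)+(D)); `lab P` labels the
  blocks of a partition by distinct `t` so that the translates `B − t` (K1) and `B − φ t` (K2) are pairwise disjoint, reading off `g₁, g₂` as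
  the uncovered residues; `rowsOf P` = all rows for `φ = P`;
* **compatibility.** `compat a b` is a NECESSARY condition for the cross condition (X) of two rows of valid data: `g₁, g₂` differ, the two
  side differences differ, and for every `δ` the set of pairs of free points of the same point orbit at difference `δ` is empty exactly when
  `δ ∈ {0, g₁(b) − g₁(a), g₂(b) − g₂(a)}` (one pass of shifted `&&&` against the doubled block word); `certOK P` says that no row of
  `rowsOf P` has `10` compatible partners in `rowsOf P` — so no `11` rows of valid data with third-pencil map `φ = P` exist;
* **φ side.** `actT/actM/actI/actS` are the generators of the symmetry group on normalised orthomorphisms (orbit relabelling `t ↦ t+1`,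
  multiplier `2`, pencil swaps `1↔2` and `0↔1`), `applyW` applies a base-4 word of generators (below a leading sentinel digit `1`),
  `pwalkFrom v L` is the completeness walker over the normalised orthomorphisms with `φ 1 = v` consuming the literal table slice `L`
  (entries `E = P ||| k <<< 44 ||| w <<< 48`) in increasing lexicographic order, and `tabOK reps L` checks that the word of every entry maps
  its `φ` to `reps[k]`.

KERNEL SHAPE (measured by designs g23 on the farm): the partition walker alone (23,631 nodes) and one label walk over the LITERAL partition table
(≈ 22k nodes, ≈ 40 s) fit in one `decide`; a label walk fed by the computed `partsEnum`, or a full `R²` scan over a computed row list, dies with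
`(kernel) excessive memory consumption` — hence the literal tables `PARTS`, `ROWSk`, `PHITABv` (`OrderElevenTriangleTableA/B`, `OrderElevenTriangleRowsA/B`)
and the run shape `partsEnum = PARTS`, `rowsFrom REPS[k] PARTS = ROWSk`, `scanG ROWSk lo hi = true` (slices of `g₁`), `pwalkFrom v PHITABv = true`,
`tabOK REPS PHITABv = true`.

Exact Python mirror: pub-namedobj-designs-g23/code/caseB/tri12k.py (E1; tri12.py = independent first engine, same rows as sets). Soundness (valid data ⇒ rows
listed and pairwise `compat`; walker and table soundness; the symmetries preserve validity) and the `decide` runs are in later files. No `sorry`, no axioms;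
nothing here asserts a census statement.
-/

set_option maxRecDepth 100000

namespace Summit.Ventures.DiscreteObjects.PP12

namespace Triangle12

/-! ## packed digits and residue sets -/

/-- digit `t` (base 16) of a packed map `Z₁₁ → Z₁₁` -/
def dig (P t : ℕ) : ℕ := (P >>> (4 * t)) &&& 15

/-- pack the values `f 0, …, f (c-1)` as base-16 digits -/
def packF (f : ℕ → ℕ) : ℕ → ℕ
  | 0 => 0
  | c + 1 => packF f c ||| (f c <<< (4 * c))

/-- the translate `B − v = {(e − v) mod 11 : e ∈ B}` of an 11-bit residue set -/
def rot (B v : ℕ) : ℕ := ((B >>> v) ||| (B <<< (11 - v))) &&& 2047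

/-- index of the first zero bit among bits `0 … 10`, scanning upwards (`11` if none; fuel `c`) -/
def fz (u : ℕ) : ℕ → ℕ
  | 0 => 11
  | c + 1 => if u.testBit (10 - c) then fz u c else 10 - c

/-! ## partitions of `{1,…,10}` with distinct internal differences (conditions (K0) + (D)) -/

/-- the new differences `±(y − e)` for the elements `e` of `cur` (fuel `c`, element `e = 11 - c`), accumulated in `nd`; `none` as soon as
one of them repeats, is already in `nd`, or is in `D` -/
def addDiffs (cur y D : ℕ) : ℕ → ℕ → Option ℕ
  | 0, nd => some nd
  | c + 1, nd =>
    if cur.testBit (11 - (c + 1)) then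
      let e := 11 - (c + 1)
      let d1 := (y + 11 - e) % 11
      let d2 := (e + 11 - y) % 11
      let b := (1 <<< d1) ||| (1 <<< d2)
      if (d1 == d2) || ((nd &&& b) != 0) || ((D &&& b) != 0) then none
      else addDiffs cur y D c (nd ||| b)
    else addDiffs cur y D c nd

/-- try to extend the open block by `y = 10 - c, …, 10` (ascending; counter `c + 1` = number of candidates left), continuing with `K` -/
def extLoop (K : ℕ → ℕ → ℕ → ℕ → ℕ → List (List ℕ)) (U D cur sz : ℕ) : ℕ → List (List ℕ)
  | 0 => []
  | c + 1 =>
    (if U.testBit (10 - c) then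
      match addDiffs cur (10 - c) D 11 0 with
      | none => []
      | some nd => K (U - (1 <<< (10 - c))) (D ||| nd) (cur ||| (1 <<< (10 - c))) (sz + 1) (10 - c)
     else []) ++ extLoop K U D cur sz c

/-- **partition walker.** State: `U` = uncovered elements (bits `1…10`), `D` = used differences, open block `cur` of size `sz` with largest
element `top`, closed blocks `blocks` (codes `mask ||| size <<< 11`, latest first). With fuel `f + 1`: CLOSE the block — finishing the
partition if nothing is uncovered (emitted iff all ten non-zero differences are used), else opening a new block at the least uncovered
element — and, alternatively, EXTEND it by every uncovered `y > top` whose differences with `cur` are new. -/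
def pgo : ℕ → ℕ → ℕ → ℕ → ℕ → ℕ → List ℕ → List (List ℕ)
  | 0, _, _, _, _, _, _ => []
  | f + 1, U, D, cur, sz, top, blocks =>
    (if U == 0 then (if D == 2046 then [(cur ||| (sz <<< 11)) :: blocks] else [])
     else pgo f (U - (1 <<< fz (2047 - U) 11)) D (1 <<< fz (2047 - U) 11) 1 (fz (2047 - U) 11) ((cur ||| (sz <<< 11)) :: blocks))
    ++ extLoop (fun U' D' cur' sz' top' => pgo f U' D' cur' sz' top' blocks) U D cur sz (10 - top)

/-- the 545 admissible block partitions of `{1,…,10}` (element `1` opens the first block) -/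
def partsEnum : List (List ℕ) := pgo 22 2044 0 2 1 1 []

/-! ## labelling the blocks (conditions (K1), (K2)) and packing rows -/

/-- insert a block code into a list sorted by size (`code >>> 11`) descending, behind equal sizes -/
def insB (b : ℕ) : List ℕ → List ℕ
  | [] => [b]
  | c :: rest => if (c >>> 11) < (b >>> 11) then b :: c :: rest else c :: insB b rest

/-- stable sort of block codes by size, descending -/
def sortB : List ℕ → List ℕ
  | [] => []
  | b :: rest => insB b (sortB rest)

/-- try the labels `t = 10 - c, …, 10` (ascending) for the block `B`: `t` unused, `B − t` disjoint from `used1`, `B − φ t` disjoint from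
`used2`; continue with `K` on the extended state (`A` receives `B` in slot `t`) -/
def labT (P B : ℕ) (K : ℕ → ℕ → ℕ → ℕ → List ℕ) (usedT used1 used2 A : ℕ) : ℕ → List ℕ
  | 0 => []
  | c + 1 =>
    (if usedT.testBit (10 - c) then []
     else if (rot B (10 - c) &&& used1) != 0 then []
     else if (rot B (dig P (10 - c)) &&& used2) != 0 then []
     else K (usedT ||| (1 <<< (10 - c))) (used1 ||| rot B (10 - c)) (used2 ||| rot B (dig P (10 - c)))
            (A ||| (B <<< (22 * (10 - c)))))
    ++ labT P B K usedT used1 used2 A c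

/-- **label walker**: all admissible labellings of the block list, each emitted as a packed row `(A <<< 8) ||| (g₁ <<< 4) ||| g₂` with
`g₁`, `g₂` the residues not covered by the translates `B − t`, `B − φ t` -/
def lab (P : ℕ) : List ℕ → ℕ → ℕ → ℕ → ℕ → List ℕ
  | [], _, used1, used2, A => [(A <<< 8) ||| (fz used1 11 <<< 4) ||| fz used2 11]
  | b :: rest, usedT, used1, used2, A => labT P (b &&& 2047) (lab P rest) usedT used1 used2 A 11

/-- the rows of all listed partitions (blocks labelled largest first) -/
def rowsFrom (P : ℕ) : List (List ℕ) → List ℕ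
  | [] => []
  | bl :: rest => lab P (sortB bl) 0 0 0 0 ++ rowsFrom P rest

/-- **all candidate rows** for the third-pencil map `φ = P` -/
def rowsOf (P : ℕ) : List ℕ := rowsFrom P partsEnum

/-! ## compatibility and the scan -/

/-- the difference pass `δ = 10 - c, …, 10`: `A &&& (B2 >>> δ)` must vanish exactly for `δ ∈ {0, d1, d2}` -/
def cz (A B2 d1 d2 : ℕ) : ℕ → Bool
  | 0 => true
  | c + 1 =>
    (if ((10 - c) == 0) || ((10 - c) == d1) || ((10 - c) == d2) then (A &&& (B2 >>> (10 - c))) == 0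
     else (A &&& (B2 >>> (10 - c))) != 0) && cz A B2 d1 d2 c

/-- **compatibility** of two packed rows (a necessary condition for (X), see the module docstring) -/
def compat (a b : ℕ) : Bool :=
  !(((a >>> 4) &&& 15) == ((b >>> 4) &&& 15)) && !((a &&& 15) == (b &&& 15)) &&
  !(((((b >>> 4) &&& 15) + 11 - ((a >>> 4) &&& 15)) % 11) == ((((b &&& 15) + 11 - (a &&& 15))) % 11)) &&
  cz (a >>> 8) ((b >>> 8) ||| ((b >>> 8) <<< 11)) ((((b >>> 4) &&& 15) + 11 - ((a >>> 4) &&& 15)) % 11)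
    (((b &&& 15) + 11 - (a &&& 15)) % 11) 11

/-- row `a` has fewer than `10` compatible partners in `rows` -/
def rowOK (rows : List ℕ) (a : ℕ) : Bool := (rows.filter (compat a)).length < 10

/-- no listed row has `10` compatible partners among the listed rows -/
def scanOK (rows : List ℕ) : Bool := rows.all (rowOK rows)

/-- the scan restricted to the listed rows whose `g₁` digit lies in `[lo, hi)` (the run files cover `[0, 16)` in slices) -/
def scanG (rows : List ℕ) (lo hi : ℕ) : Bool :=
  (rows.filter fun a => (lo ≤ ((a >>> 4) &&& 15)) && (((a >>> 4) &&& 15) < hi)).all (rowOK rows)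

/-- **the certificate for `φ = P`**: no candidate row has `10` compatible candidate partners -/
def certOK (P : ℕ) : Bool := scanOK (rowsOf P)

/-! ## the symmetry generators on packed maps, words, the table check -/

/-- first position `s ∈ {10 - c + …}` (ascending from `11 - c`) with `dig P s = v` (`11` if none) -/
def posOf (P v : ℕ) : ℕ → ℕ
  | 0 => 11
  | c + 1 => if dig P (10 - c) == v then 10 - c else posOf P v c

/-- generator `T` (relabel the point orbits `t ↦ t + 1`, renormalise): `φ'(t) = φ(t − 1) − φ(10)` -/
def actT (P : ℕ) : ℕ := packF (fun t => (dig P ((t + 10) % 11) + 11 - dig P 10) % 11) 11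

/-- generator `M` (multiplier `2`): `φ'(t) = 2·φ(6t)` -/
def actM (P : ℕ) : ℕ := packF (fun t => (2 * dig P ((6 * t) % 11)) % 11) 11

/-- generator `I` (swap the pencils `1 ↔ 2`): `φ' = φ⁻¹` -/
def actI (P : ℕ) : ℕ := packF (fun t => posOf P t 11) 11

/-- generator `S` (swap the pencils `0 ↔ 1`): `φ'(t) = φ(−t) + t` -/
def actS (P : ℕ) : ℕ := packF (fun t => (dig P ((11 - t) % 11) + t) % 11) 11

/-- one generator by number -/
def act (g P : ℕ) : ℕ := if g == 0 then actT P else if g == 1 then actM P else if g == 2 then actI P else actS P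

/-- apply the base-4 word `w` (least significant digit first, below a leading sentinel digit `1`; fuel `f`) -/
def applyW : ℕ → ℕ → ℕ → ℕ
  | _, P, 0 => P
  | w, P, f + 1 => if w < 2 then P else applyW (w / 4) (act (w % 4) P) f

/-- every table entry `E = P ||| (k <<< 44) ||| (w <<< 48)` satisfies `applyW w P = reps[k]` -/
def tabOK (reps L : List ℕ) : Bool :=
  L.all fun E => applyW (E >>> 48) (E &&& 17592186044415) 20 == reps.getD ((E >>> 44) &&& 15) 0

/-! ## the completeness walker over normalised orthomorphisms -/

/-- one value `v` at position `t`: skip if the value or the difference `t − v` is used, else descend with `W` -/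
def pstep (t usedV usedD P : ℕ) (W : ℕ → ℕ → ℕ → List ℕ → Option (List ℕ)) (v : ℕ) (rest : List ℕ) : Option (List ℕ) :=
  if usedV.testBit v then some rest
  else if usedD.testBit ((t + 11 - v) % 11) then some rest
  else W (usedV ||| (1 <<< v)) (usedD ||| (1 <<< ((t + 11 - v) % 11))) (P ||| (v <<< (4 * t))) rest

/-- try the values `v = 11 − c, …, 10` (ascending) at position `t`, threading the literal list -/
def pwalkV (t usedV usedD P : ℕ) (W : ℕ → ℕ → ℕ → List ℕ → Option (List ℕ)) : ℕ → List ℕ → Option (List ℕ)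
  | 0, rest => some rest
  | c + 1, rest =>
    match pstep t usedV usedD P W (11 - (c + 1)) rest with
    | none => none
    | some rest' => pwalkV t usedV usedD P W c rest'

/-- **the φ-walker** (positions `t, t+1, …`, fuel `f`): at a complete map it CONSUMES the head of the literal list if its low 44 bits are the
packed map (else fails) -/
def pwalk : ℕ → ℕ → ℕ → ℕ → ℕ → List ℕ → Option (List ℕ)
  | 0, _, _, _, P, rest =>
    match rest with
    | [] => none
    | E :: rest' => if (E &&& 17592186044415) == P then some rest' else none
  | f + 1, t, usedV, usedD, P, rest => pwalkV t usedV usedD P (pwalk f (t + 1)) 10 rest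

/-- `some []` test -/
def isSomeNil : Option (List ℕ) → Bool
  | some [] => true
  | _ => false

/-- the walk over the normalised orthomorphisms (`φ 0 = 0`, `φ` and `t ↦ t − φ t` injective) with `φ 1 = v`, consuming the slice `L` exactly -/
def pwalkFrom (v : ℕ) (L : List ℕ) : Bool :=
  isSomeNil (pwalk 9 2 (1 ||| (1 <<< v)) (1 ||| (1 <<< ((12 - v) % 11))) (v <<< 4) L)

end Triangle12

end Summit.Ventures.DiscreteObjects.PP12
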